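import Summits.NavierStokesRegularity.NavierStokesRegularity.Theorems.GaldiLiouvilleGateRecordZoomAncientBumpOfZooms
import HarnessLib

/-!
# Route `GaldiLiouvilleGate`, crux `RecordZoomAncient` (stmt-NavierStokesRegularity-0894),
  line `registered` — THE REGISTERED KERNEL `stub_oscillationKernel` (S8) IS EQUIVALENT TO THE CLEAN KERNEL (K)
  "every blow-up carries a persistent critical oscillation bump"

Lead `prover-line-stmt-NavierStokesRegularity-0894-c5-0`, 2026-08-17. Namespace `…Theorems.RecordZoomAncient.Birth`.
Notation as in `GaldiLiouvilleGateRecordZoomAncientBumpOfZooms.lean`: `E(s) = ∫⁻ |∇u(s)|²`, dominating levels,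
enstrophy-normalised zooms, persistent critical oscillation bumps. The registered open stub S8 of
`Cruxes/RecordZoomAncient/Lines/birth.lean` (r8) says: for a classical Leray–Hopf solution from a rapidly decaying
datum with no smooth extension past `T`, the properties (1) Type-II enstrophy, (2) eventually slow doubling at every
scale, (3) vanishing at the critical scale, (4) faintness and (5″) "no persistent critical oscillation bump" cannot
hold together. The clean kernel (K) (`recordZoomAncient_of_blowupCarriesBump`, p172480) says: every such solution
carries a persistent critical oscillation bump. (K) ⟹ S8 is trivial; S8 ⟹ (K) is the content of this file: if one
of (1)–(4) fails, the r5 branches of the line (`stub_typeIBranch` / `stub_fastBranch` /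
`stub_enstrophyConcentrationBranch` / `stub_velocityBranch`, with Leray's `L^∞` rate and the Tao representation)
produce velocity-concentrated enstrophy zooms, and those produce a bump
(`exists_oscillationBump_of_concentratedZooms`, p172827); if (1)–(4) hold, S8 itself produces the bump (classically).

* `exists_concentratedZooms_of_kernelAt` — the r5 case split, pointwise in the solution, with the concentrated zooms
  EXPORTED (the body of `stub_kernelAt`, p162337, stopped before its tail);
* `exists_oscillationBump_of_oscillationKernelAt` — S8 at a fixed solution ⟹ a bump of that solution;
* `blowupCarriesBump_of_oscillationKernel` — S8 (closed, verbatim) ⟹ (K) (closed, verbatim as in p172480);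
* `oscillationKernel_of_blowupCarriesBump` — (K) ⟹ S8.

Hence the line's residual is EXACTLY (K), kernel-checked: `Z ⟸ (K) ⟺ S8 ⟸ S7 ⟸ FCV` (p172480, this file, p166059,
p166562, p159288).
-/

noncomputable section

open Set MeasureTheory Filter Topology Function
open scoped ENNReal NNReal
open Literature.Analysis.FluidPDE

namespace Summit.NavierStokesRegularity.NavierStokesRegularity.Theorems.RecordZoomAncient.Birth

-- the problem-side namespace `Summit.NavierStokesRegularity.NavierStokesRegularity.…` (summit =
-- problem for this single-problem summit) duplicates `NavierStokesRegularity` by design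
set_option linter.dupNamespace false

/-- **The r5 case split with the concentrated zooms exported.** For fixed `ν, T > 0` and a classical solution
`(u, p)` on `ℝ³ × [0, T)`, Leray–Hopf from the rapidly decaying `u 0`, with no smooth extension past `T`: if the four
structural properties (1) Type-II enstrophy, (2) eventually slow doubling at every scale, (3) vanishing of the
enstrophy at the critical scale, (4) faintness cannot hold together FOR THIS SOLUTION, then there are
velocity-concentrated enstrophy-normalised zooms: base times `tc n ∈ (0,T)`, centres `xc n`, levels `L n > 0`
dominating `E` on `[0, tc n]` with `tc n (L n)² → ∞`, and a rescaled time `s₀ < 0` with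
`‖(ν/L n) u(tc n + ν³ s₀/(L n)², xc n)‖ ≥ θ > 0`. Proof: the body of `stub_kernelAt` (p162337) — Tao representation,
persistence constants, Leray's `L^∞` rate, the universal velocity bound, and the four-fold case split over the landed
branches — stopped before the common tail. -/
theorem exists_concentratedZooms_of_kernelAt :
    ∀ (ν T : ℝ), 0 < ν → 0 < T →
      ∀ (u : ℝ → EuclideanSpace ℝ (Fin 3) → EuclideanSpace ℝ (Fin 3)) (p : ℝ → EuclideanSpace ℝ (Fin 3) → ℝ),
        IsClassicalNSSolutionOn (Set.Ico 0 T) ν 0 u p → IsLerayHopfOn T ν 0 (u 0) u →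
        HasRapidSpatialDecay (u 0) → ¬ HasSmoothExtensionPast ν 0 u T →
        
        ((∀ C : ℝ, 0 < C → ∃ t' ∈ Set.Ico 0 T, ∀ t ∈ Set.Ico t' T, ∃ s ∈ Set.Icc 0 t,
            ENNReal.ofReal (C * (ν * Real.sqrt ν) / Real.sqrt (T - t)) <
              ∫⁻ x, ENNReal.ofReal (frobeniusNormSq (fderiv ℝ (u s) x))) →
          (∀ K : ℝ, 0 < K → ∃ t' ∈ Set.Ico 0 T, ∀ t₁ ∈ Set.Ico t' T, ∀ t₂ ∈ Set.Ioo t₁ T, ∀ L : ℝ, 0 < L →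
            (∀ s ∈ Set.Icc 0 t₂,
              (∫⁻ x, ENNReal.ofReal (frobeniusNormSq (fderiv ℝ (u s) x))) ≤ ENNReal.ofReal (2 * L)) →
            (∫⁻ x, ENNReal.ofReal (frobeniusNormSq (fderiv ℝ (u t₁) x))) ≤ ENNReal.ofReal L →
            ENNReal.ofReal (2 * L) ≤ (∫⁻ x, ENNReal.ofReal (frobeniusNormSq (fderiv ℝ (u t₂) x))) →
            K * ν ^ 3 / L ^ 2 ≤ t₂ - t₁) →
          (∀ R ε : ℝ, 0 < R → 0 < ε → ∃ t' ∈ Set.Ico 0 T, ∀ t ∈ Set.Ico t' T,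
            ∀ x : EuclideanSpace ℝ (Fin 3), ∀ L : ℝ, 0 < L →
            (∀ s ∈ Set.Icc 0 t,
              (∫⁻ x, ENNReal.ofReal (frobeniusNormSq (fderiv ℝ (u s) x))) ≤ ENNReal.ofReal L) →
            3 * ν ^ 3 / L ^ 2 ≤ t →
            (∫⁻ y in Metric.ball x (R * ν ^ 2 / L), ENNReal.ofReal (frobeniusNormSq (fderiv ℝ (u t) y))) <
              ENNReal.ofReal (ε * L)) →
          (∀ θ : ℝ, 0 < θ → ∃ t' ∈ Set.Ico 0 T, ∀ t ∈ Set.Ico t' T,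
            ∀ x : EuclideanSpace ℝ (Fin 3), ∀ L : ℝ, 0 < L →
            (∀ s ∈ Set.Icc 0 t,
              (∫⁻ x, ENNReal.ofReal (frobeniusNormSq (fderiv ℝ (u s) x))) ≤ ENNReal.ofReal L) →
            ‖u t x‖ < θ * L / ν) →
          False) →
        ∃ (tc : ℕ → ℝ) (xc : ℕ → EuclideanSpace ℝ (Fin 3)) (L : ℕ → ℝ) (s₀ θ : ℝ),
          s₀ < 0 ∧ 0 < θ ∧ (∀ n, 0 < tc n ∧ tc n < T) ∧ (∀ n, 0 < L n) ∧
          (∀ n, ∀ t ∈ Set.Icc 0 (tc n),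
            ∫⁻ x, ENNReal.ofReal (frobeniusNormSq (fderiv ℝ (u t) x)) ≤ ENNReal.ofReal (L n)) ∧
          Tendsto (fun n => tc n * L n ^ 2) atTop atTop ∧
          (∀ n, θ ≤ ‖(ν / L n) • u (tc n + ν ^ 3 / L n ^ 2 * s₀) (xc n)‖) := by
  intro ν T hν hT u p hcl hLH hdec hnext hKernelAt
  -- (0) the representation: `u` is Tao-class on every `[0, T']`, `T' < T`
  have hrep : ∀ T' ∈ Set.Ioo 0 T, ∃ P : ℝ → EuclideanSpace ℝ (Fin 3) → ℝ, IsTaoSolutionOn T' ν (u 0) u P :=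
    stub_taoRep ν T hν hT u p hcl hLH hdec
  -- (1) persistence constants
  obtain ⟨cP, K, hcP, hK, hpers⟩ := stub_enstrophyPersistence
  have hpers' := hpers ν T hν hT u p hcl hrep
  -- Leray's `L^∞` blow-up rate (tree theorem), strip-boundedness from the representation
  obtain ⟨cL, hcL, hLer⟩ := leray_blowup_rate_top_holds
  have hstrip : ∀ T' ∈ Set.Ioo 0 T,
      eLpNorm (uncurry u) ∞ (volume.restrict (Set.Icc 0 T' ×ˢ univ)) < ∞ := by
    intro T' hT'
    obtain ⟨P, hP⟩ := hrep T' hT'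
    obtain ⟨B, -, hB⟩ := hP.exists_bound_velocity
    rw [eLpNorm_exponent_top]
    refine eLpNormEssSup_lt_top_of_ae_bound (C := B) ?_
    filter_upwards [ae_restrict_mem (measurableSet_Icc.prod MeasurableSet.univ)] with w hw
    obtain ⟨t, x⟩ := w
    exact hB t hw.1 x
  have hrate : ∀ t ∈ Set.Ico 0 T, ∃ x, cL / 2 * Real.sqrt ν / Real.sqrt (T - t) ≤ ‖u t x‖ := by
    intro t ht
    have h := hLer ν T hν hT u p ⟨hcl, hnext⟩ hLH hstrip t ht
    have ha : 0 < cL * Real.sqrt ν / Real.sqrt (T - t) := by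
      have h1 : 0 < Real.sqrt ν := Real.sqrt_pos.2 hν
      have h2 : 0 < Real.sqrt (T - t) := Real.sqrt_pos.2 (sub_pos.2 ht.2)
      positivity
    obtain ⟨x, hx⟩ := exists_half_le_norm_of_ofReal_le_eLpNorm_top ha h
    refine ⟨x, ?_⟩
    have heq : cL / 2 * Real.sqrt ν / Real.sqrt (T - t) = cL * Real.sqrt ν / Real.sqrt (T - t) / 2 := by ring
    rw [heq]
    exact hx
  -- the universal velocity bound of `stub_zoomBound` (its constant feeds the `C^{1,κ}` constants)
  obtain ⟨C, hC⟩ := stub_zoomBound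
  -- (2) concentrated enstrophy-normalised zooms, by the case splits (Type-I enstrophy / fast doubling /
  -- enstrophy concentration / frequent critical velocity / the kernel)
  have hZ :
      ∃ (tc : ℕ → ℝ) (xc : ℕ → EuclideanSpace ℝ (Fin 3)) (L : ℕ → ℝ) (s₀ θ : ℝ),
        s₀ < 0 ∧ 0 < θ ∧ (∀ n, 0 < tc n ∧ tc n < T) ∧ (∀ n, 0 < L n) ∧
        (∀ n, ∀ t ∈ Set.Icc 0 (tc n),
          ∫⁻ x, ENNReal.ofReal (frobeniusNormSq (fderiv ℝ (u t) x)) ≤ ENNReal.ofReal (L n)) ∧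
        Tendsto (fun n => tc n * L n ^ 2) atTop atTop ∧
        (∀ n, θ ≤ ‖(ν / L n) • u (tc n + ν ^ 3 / L n ^ 2 * s₀) (xc n)‖) := by
    by_cases hI : ∃ C : ℝ, 0 < C ∧ ∀ t' ∈ Set.Ico 0 T, ∃ t ∈ Set.Ico t' T, ∀ s ∈ Set.Icc 0 t,
        (∫⁻ x, ENNReal.ofReal (frobeniusNormSq (fderiv ℝ (u s) x))) ≤
          ENNReal.ofReal (C * (ν * Real.sqrt ν) / Real.sqrt (T - t))
    · obtain ⟨C, hC, hI⟩ := hI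
      exact stub_typeIBranch ν T hν hT u p hcl (cL / 2) (by positivity) hrate cP K hcP hK hpers' C hC hI
    · push Not at hI
      by_cases hFD : ∃ K : ℝ, 0 < K ∧ ∀ t' ∈ Set.Ico 0 T, ∃ t₁ ∈ Set.Ico t' T, ∃ t₂ ∈ Set.Ioo t₁ T,
          ∃ L : ℝ, 0 < L ∧
            (∀ s ∈ Set.Icc 0 t₂,
              (∫⁻ x, ENNReal.ofReal (frobeniusNormSq (fderiv ℝ (u s) x))) ≤ ENNReal.ofReal (2 * L)) ∧
            (∫⁻ x, ENNReal.ofReal (frobeniusNormSq (fderiv ℝ (u t₁) x))) ≤ ENNReal.ofReal L ∧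
            ENNReal.ofReal (2 * L) ≤ (∫⁻ x, ENNReal.ofReal (frobeniusNormSq (fderiv ℝ (u t₂) x))) ∧
            t₂ - t₁ < K * ν ^ 3 / L ^ 2
      · obtain ⟨K₀, hK₀, hFD⟩ := hFD
        exact stub_fastBranch ν T hν hT u p hcl hLH hrep hnext cP K hcP hK hpers' K₀ hK₀ hFD
      · push Not at hFD
        obtain ⟨C₁, H, κ, hκ, hC1k⟩ := stub_zoomC1kappa stub_oseenC1kappa C hC
        have hC1k' := hC1k ν T hν hT u p hcl hLH hdec hrep
        by_cases hEC : ∃ R ε : ℝ, 0 < R ∧ 0 < ε ∧ ∀ t' ∈ Set.Ico 0 T, ∃ t ∈ Set.Ico t' T,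
            ∃ x : EuclideanSpace ℝ (Fin 3), ∃ L : ℝ, 0 < L ∧
              (∀ s ∈ Set.Icc 0 t,
                (∫⁻ x, ENNReal.ofReal (frobeniusNormSq (fderiv ℝ (u s) x))) ≤ ENNReal.ofReal L) ∧
              3 * ν ^ 3 / L ^ 2 ≤ t ∧
              ENNReal.ofReal (ε * L) ≤
                ∫⁻ y in Metric.ball x (R * ν ^ 2 / L), ENNReal.ofReal (frobeniusNormSq (fderiv ℝ (u t) y))
        · obtain ⟨R, ε, hR, hε, hEC⟩ := hEC
          exact stub_enstrophyConcentrationBranch ν T hν hT u p hcl hLH hrep hnext cP K hcP hK hpers'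
            C₁ H κ hκ hC1k' R ε hR hε hEC
        · push Not at hEC
          by_cases hV : ∃ θ : ℝ, 0 < θ ∧ ∀ t' ∈ Set.Ico 0 T, ∃ t ∈ Set.Ico t' T,
              ∃ x : EuclideanSpace ℝ (Fin 3), ∃ L : ℝ, 0 < L ∧
                (∀ s ∈ Set.Icc 0 t,
                  (∫⁻ x, ENNReal.ofReal (frobeniusNormSq (fderiv ℝ (u s) x))) ≤ ENNReal.ofReal L) ∧
                θ * L / ν ≤ ‖u t x‖
          · obtain ⟨θ, hθ, hV⟩ := hV
            exact stub_velocityBranch ν T hν hT u p hcl hLH hrep hnext cP K hcP hK hpers' θ hθ hV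
          · push Not at hV
            exact (hKernelAt hI hFD hEC hV).elim
  exact hZ

/-- **S8 at a fixed solution gives a bump of that solution.** For fixed `ν, T > 0` and a classical solution `(u, p)`
on `ℝ³ × [0, T)`, Leray–Hopf from the rapidly decaying `u 0`, with no smooth extension past `T`: if (1) ∧ (2) ∧ (3) ∧
(4) ∧ (5″) is contradictory FOR THIS SOLUTION (the registered stub `stub_oscillationKernel` specialised to it), then
the solution carries a persistent critical oscillation bump. Proof: if there is no bump, (5″) holds, so the pointwise
kernel of `exists_concentratedZooms_of_kernelAt` holds, whence concentrated zooms, whence a bump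
(`exists_oscillationBump_of_concentratedZooms`) — contradiction. -/
theorem exists_oscillationBump_of_oscillationKernelAt :
    ∀ (ν T : ℝ), 0 < ν → 0 < T →
      ∀ (u : ℝ → EuclideanSpace ℝ (Fin 3) → EuclideanSpace ℝ (Fin 3)) (p : ℝ → EuclideanSpace ℝ (Fin 3) → ℝ),
        IsClassicalNSSolutionOn (Set.Ico 0 T) ν 0 u p → IsLerayHopfOn T ν 0 (u 0) u →
        HasRapidSpatialDecay (u 0) → ¬ HasSmoothExtensionPast ν 0 u T →
        
        ((∀ C : ℝ, 0 < C → ∃ t' ∈ Set.Ico 0 T, ∀ t ∈ Set.Ico t' T, ∃ s ∈ Set.Icc 0 t,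
            ENNReal.ofReal (C * (ν * Real.sqrt ν) / Real.sqrt (T - t)) <
              ∫⁻ x, ENNReal.ofReal (frobeniusNormSq (fderiv ℝ (u s) x))) →
          (∀ K : ℝ, 0 < K → ∃ t' ∈ Set.Ico 0 T, ∀ t₁ ∈ Set.Ico t' T, ∀ t₂ ∈ Set.Ioo t₁ T, ∀ L : ℝ, 0 < L →
            (∀ s ∈ Set.Icc 0 t₂,
              (∫⁻ x, ENNReal.ofReal (frobeniusNormSq (fderiv ℝ (u s) x))) ≤ ENNReal.ofReal (2 * L)) →
            (∫⁻ x, ENNReal.ofReal (frobeniusNormSq (fderiv ℝ (u t₁) x))) ≤ ENNReal.ofReal L →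
            ENNReal.ofReal (2 * L) ≤ (∫⁻ x, ENNReal.ofReal (frobeniusNormSq (fderiv ℝ (u t₂) x))) →
            K * ν ^ 3 / L ^ 2 ≤ t₂ - t₁) →
          (∀ R ε : ℝ, 0 < R → 0 < ε → ∃ t' ∈ Set.Ico 0 T, ∀ t ∈ Set.Ico t' T,
            ∀ x : EuclideanSpace ℝ (Fin 3), ∀ L : ℝ, 0 < L →
            (∀ s ∈ Set.Icc 0 t,
              (∫⁻ x, ENNReal.ofReal (frobeniusNormSq (fderiv ℝ (u s) x))) ≤ ENNReal.ofReal L) →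
            3 * ν ^ 3 / L ^ 2 ≤ t →
            (∫⁻ y in Metric.ball x (R * ν ^ 2 / L), ENNReal.ofReal (frobeniusNormSq (fderiv ℝ (u t) y))) <
              ENNReal.ofReal (ε * L)) →
          (∀ θ : ℝ, 0 < θ → ∃ t' ∈ Set.Ico 0 T, ∀ t ∈ Set.Ico t' T,
            ∀ x : EuclideanSpace ℝ (Fin 3), ∀ L : ℝ, 0 < L →
            (∀ s ∈ Set.Icc 0 t,
              (∫⁻ x, ENNReal.ofReal (frobeniusNormSq (fderiv ℝ (u s) x))) ≤ ENNReal.ofReal L) →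
            ‖u t x‖ < θ * L / ν) →
          (∀ (tc : ℕ → ℝ) (x₁ x₂ : ℕ → EuclideanSpace ℝ (Fin 3)) (M : ℕ → ℝ) (θ R₀ D : ℝ),
          (∀ n, 0 < tc n ∧ tc n < T) → (∀ n, 0 < M n) →
          (∀ n, ∀ t ∈ Set.Icc 0 (tc n), ∀ x, ‖u t x‖ ≤ M n) →
          Tendsto (fun n => tc n * M n ^ 2) atTop atTop →
          0 < θ → 0 < R₀ → (∀ n, ‖x₁ n - x₂ n‖ ≤ R₀ * (ν / M n)) →
          (∀ n, θ * M n ≤ ‖u (tc n) (x₁ n) - u (tc n) (x₂ n)‖) →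
          (∀ R S : ℝ, 0 < R → 0 < S → ∀ᶠ n in atTop, ∀ t ∈ Set.Icc 0 (tc n), tc n - S * (ν / M n ^ 2) ≤ t →
            (∫⁻ y in Metric.ball (x₁ n) (R * (ν / M n)), ENNReal.ofReal (frobeniusNormSq (fderiv ℝ (u t) y))) ≤
              ENNReal.ofReal (D * (ν * M n))) →
          False) →
          False) →
        ∃ (tb : ℕ → ℝ) (x₁ x₂ : ℕ → EuclideanSpace ℝ (Fin 3)) (M : ℕ → ℝ) (θ' R₀ D : ℝ),
          (∀ n, 0 < tb n ∧ tb n < T) ∧ (∀ n, 0 < M n) ∧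
          (∀ n, ∀ t ∈ Set.Icc 0 (tb n), ∀ x, ‖u t x‖ ≤ M n) ∧
          Filter.Tendsto (fun n => tb n * M n ^ 2) Filter.atTop Filter.atTop ∧
          0 < θ' ∧ 0 < R₀ ∧ (∀ n, ‖x₁ n - x₂ n‖ ≤ R₀ * (ν / M n)) ∧
          (∀ n, θ' * M n ≤ ‖u (tb n) (x₁ n) - u (tb n) (x₂ n)‖) ∧
          (∀ R S : ℝ, 0 < R → 0 < S → ∀ᶠ n in Filter.atTop, ∀ t ∈ Set.Icc 0 (tb n),
            tb n - S * (ν / M n ^ 2) ≤ t →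
            (∫⁻ y in Metric.ball (x₁ n) (R * (ν / M n)), ENNReal.ofReal (frobeniusNormSq (fderiv ℝ (u t) y))) ≤
              ENNReal.ofReal (D * (ν * M n))) := by
  intro ν T hν hT u p hcl hLH hdec hnext hK8
  by_contra hnb
  obtain ⟨tc, xc, L, s₀, θ, hs₀, hθ, htc, hL, hdom, hpast, hconc⟩ :=
    exists_concentratedZooms_of_kernelAt ν T hν hT u p hcl hLH hdec hnext fun h1 h2 h3 h4 =>
      hK8 h1 h2 h3 h4 fun tb x₁ x₂ M θ R₀ D ha hb hc hd he hf hg hh hi =>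
        hnb ⟨tb, x₁, x₂, M, θ, R₀, D, ha, hb, hc, hd, he, hf, hg, hh, hi⟩
  exact hnb (exists_oscillationBump_of_concentratedZooms ν T hν hT u p hcl hLH hdec tc xc L s₀ θ hs₀ hθ htc hL
    hdom hpast hconc)

/-- **S8 ⟹ (K).** The registered stub `stub_oscillationKernel` of `Cruxes/RecordZoomAncient/Lines/birth.lean` (r8),
verbatim and universally closed, implies the clean kernel (K) "every blow-up carries a persistent critical
oscillation bump", verbatim as the hypothesis of `recordZoomAncient_of_blowupCarriesBump` (p172480). -/
theorem blowupCarriesBump_of_oscillationKernel :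
    (∀ (ν T : ℝ), 0 < ν → 0 < T →
      ∀ (u : ℝ → EuclideanSpace ℝ (Fin 3) → EuclideanSpace ℝ (Fin 3)) (p : ℝ → EuclideanSpace ℝ (Fin 3) → ℝ),
        IsClassicalNSSolutionOn (Set.Ico 0 T) ν 0 u p → IsLerayHopfOn T ν 0 (u 0) u →
        HasRapidSpatialDecay (u 0) → ¬ HasSmoothExtensionPast ν 0 u T →
        (∀ C : ℝ, 0 < C → ∃ t' ∈ Set.Ico 0 T, ∀ t ∈ Set.Ico t' T, ∃ s ∈ Set.Icc 0 t,
            ENNReal.ofReal (C * (ν * Real.sqrt ν) / Real.sqrt (T - t)) <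
              ∫⁻ x, ENNReal.ofReal (frobeniusNormSq (fderiv ℝ (u s) x))) →
        (∀ K : ℝ, 0 < K → ∃ t' ∈ Set.Ico 0 T, ∀ t₁ ∈ Set.Ico t' T, ∀ t₂ ∈ Set.Ioo t₁ T, ∀ L : ℝ, 0 < L →
            (∀ s ∈ Set.Icc 0 t₂,
              (∫⁻ x, ENNReal.ofReal (frobeniusNormSq (fderiv ℝ (u s) x))) ≤ ENNReal.ofReal (2 * L)) →
            (∫⁻ x, ENNReal.ofReal (frobeniusNormSq (fderiv ℝ (u t₁) x))) ≤ ENNReal.ofReal L →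
            ENNReal.ofReal (2 * L) ≤ (∫⁻ x, ENNReal.ofReal (frobeniusNormSq (fderiv ℝ (u t₂) x))) →
            K * ν ^ 3 / L ^ 2 ≤ t₂ - t₁) →
        (∀ R ε : ℝ, 0 < R → 0 < ε → ∃ t' ∈ Set.Ico 0 T, ∀ t ∈ Set.Ico t' T,
            ∀ x : EuclideanSpace ℝ (Fin 3), ∀ L : ℝ, 0 < L →
            (∀ s ∈ Set.Icc 0 t,
              (∫⁻ x, ENNReal.ofReal (frobeniusNormSq (fderiv ℝ (u s) x))) ≤ ENNReal.ofReal L) →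
            3 * ν ^ 3 / L ^ 2 ≤ t →
            (∫⁻ y in Metric.ball x (R * ν ^ 2 / L), ENNReal.ofReal (frobeniusNormSq (fderiv ℝ (u t) y))) <
              ENNReal.ofReal (ε * L)) →
        (∀ θ : ℝ, 0 < θ → ∃ t' ∈ Set.Ico 0 T, ∀ t ∈ Set.Ico t' T,
            ∀ x : EuclideanSpace ℝ (Fin 3), ∀ L : ℝ, 0 < L →
            (∀ s ∈ Set.Icc 0 t,
              (∫⁻ x, ENNReal.ofReal (frobeniusNormSq (fderiv ℝ (u s) x))) ≤ ENNReal.ofReal L) →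
            ‖u t x‖ < θ * L / ν) →
        (∀ (tc : ℕ → ℝ) (x₁ x₂ : ℕ → EuclideanSpace ℝ (Fin 3)) (M : ℕ → ℝ) (θ R₀ D : ℝ),
          (∀ n, 0 < tc n ∧ tc n < T) → (∀ n, 0 < M n) →
          (∀ n, ∀ t ∈ Set.Icc 0 (tc n), ∀ x, ‖u t x‖ ≤ M n) →
          Tendsto (fun n => tc n * M n ^ 2) atTop atTop →
          0 < θ → 0 < R₀ → (∀ n, ‖x₁ n - x₂ n‖ ≤ R₀ * (ν / M n)) →
          (∀ n, θ * M n ≤ ‖u (tc n) (x₁ n) - u (tc n) (x₂ n)‖) →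
          (∀ R S : ℝ, 0 < R → 0 < S → ∀ᶠ n in atTop, ∀ t ∈ Set.Icc 0 (tc n), tc n - S * (ν / M n ^ 2) ≤ t →
            (∫⁻ y in Metric.ball (x₁ n) (R * (ν / M n)), ENNReal.ofReal (frobeniusNormSq (fderiv ℝ (u t) y))) ≤
              ENNReal.ofReal (D * (ν * M n))) →
          False) →
        False) →
    (∀ (ν T : ℝ), 0 < ν → 0 < T → ∀ (u : ℝ → EuclideanSpace ℝ (Fin 3) → EuclideanSpace ℝ (Fin 3)) (p : ℝ →
      EuclideanSpace ℝ (Fin 3) → ℝ), IsClassicalNSSolutionOn (Set.Ico 0 T) ν 0 u p → IsLerayHopfOn T ν 0 (u 0)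
      u → HasRapidSpatialDecay (u 0) → ¬ HasSmoothExtensionPast ν 0 u T →
      ∃ (tc : ℕ → ℝ) (x₁ x₂ : ℕ → EuclideanSpace ℝ (Fin 3)) (M : ℕ → ℝ) (θ R₀ D : ℝ),
        (∀ n, 0 < tc n ∧ tc n < T) ∧ (∀ n, 0 < M n) ∧
        (∀ n, ∀ t ∈ Set.Icc 0 (tc n), ∀ x, ‖u t x‖ ≤ M n) ∧
        Filter.Tendsto (fun n => tc n * M n ^ 2) Filter.atTop Filter.atTop ∧
        0 < θ ∧ 0 < R₀ ∧ (∀ n, ‖x₁ n - x₂ n‖ ≤ R₀ * (ν / M n)) ∧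
        (∀ n, θ * M n ≤ ‖u (tc n) (x₁ n) - u (tc n) (x₂ n)‖) ∧
        (∀ R S : ℝ, 0 < R → 0 < S → ∀ᶠ n in Filter.atTop, ∀ t ∈ Set.Icc 0 (tc n),
          tc n - S * (ν / M n ^ 2) ≤ t →
          (∫⁻ y in Metric.ball (x₁ n) (R * (ν / M n)), ENNReal.ofReal (frobeniusNormSq (fderiv ℝ (u t) y))) ≤
            ENNReal.ofReal (D * (ν * M n)))) :=
  fun hS8 ν T hν hT u p hcl hLH hdec hnext =>
    exists_oscillationBump_of_oscillationKernelAt ν T hν hT u p hcl hLH hdec hnext (hS8 ν T hν hT u p hcl hLH hdec hnext)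

/-- **(K) ⟹ S8** (trivial direction): a bump contradicts (5″). Together with
`blowupCarriesBump_of_oscillationKernel`: the registered stub S8 and the clean kernel (K) are equivalent. -/
theorem oscillationKernel_of_blowupCarriesBump :
    (∀ (ν T : ℝ), 0 < ν → 0 < T → ∀ (u : ℝ → EuclideanSpace ℝ (Fin 3) → EuclideanSpace ℝ (Fin 3)) (p : ℝ →
      EuclideanSpace ℝ (Fin 3) → ℝ), IsClassicalNSSolutionOn (Set.Ico 0 T) ν 0 u p → IsLerayHopfOn T ν 0 (u 0)
      u → HasRapidSpatialDecay (u 0) → ¬ HasSmoothExtensionPast ν 0 u T →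
      ∃ (tc : ℕ → ℝ) (x₁ x₂ : ℕ → EuclideanSpace ℝ (Fin 3)) (M : ℕ → ℝ) (θ R₀ D : ℝ),
        (∀ n, 0 < tc n ∧ tc n < T) ∧ (∀ n, 0 < M n) ∧
        (∀ n, ∀ t ∈ Set.Icc 0 (tc n), ∀ x, ‖u t x‖ ≤ M n) ∧
        Filter.Tendsto (fun n => tc n * M n ^ 2) Filter.atTop Filter.atTop ∧
        0 < θ ∧ 0 < R₀ ∧ (∀ n, ‖x₁ n - x₂ n‖ ≤ R₀ * (ν / M n)) ∧
        (∀ n, θ * M n ≤ ‖u (tc n) (x₁ n) - u (tc n) (x₂ n)‖) ∧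
        (∀ R S : ℝ, 0 < R → 0 < S → ∀ᶠ n in Filter.atTop, ∀ t ∈ Set.Icc 0 (tc n),
          tc n - S * (ν / M n ^ 2) ≤ t →
          (∫⁻ y in Metric.ball (x₁ n) (R * (ν / M n)), ENNReal.ofReal (frobeniusNormSq (fderiv ℝ (u t) y))) ≤
            ENNReal.ofReal (D * (ν * M n)))) →
    (∀ (ν T : ℝ), 0 < ν → 0 < T →
      ∀ (u : ℝ → EuclideanSpace ℝ (Fin 3) → EuclideanSpace ℝ (Fin 3)) (p : ℝ → EuclideanSpace ℝ (Fin 3) → ℝ),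
        IsClassicalNSSolutionOn (Set.Ico 0 T) ν 0 u p → IsLerayHopfOn T ν 0 (u 0) u →
        HasRapidSpatialDecay (u 0) → ¬ HasSmoothExtensionPast ν 0 u T →
        (∀ C : ℝ, 0 < C → ∃ t' ∈ Set.Ico 0 T, ∀ t ∈ Set.Ico t' T, ∃ s ∈ Set.Icc 0 t,
            ENNReal.ofReal (C * (ν * Real.sqrt ν) / Real.sqrt (T - t)) <
              ∫⁻ x, ENNReal.ofReal (frobeniusNormSq (fderiv ℝ (u s) x))) →
        (∀ K : ℝ, 0 < K → ∃ t' ∈ Set.Ico 0 T, ∀ t₁ ∈ Set.Ico t' T, ∀ t₂ ∈ Set.Ioo t₁ T, ∀ L : ℝ, 0 < L →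
            (∀ s ∈ Set.Icc 0 t₂,
              (∫⁻ x, ENNReal.ofReal (frobeniusNormSq (fderiv ℝ (u s) x))) ≤ ENNReal.ofReal (2 * L)) →
            (∫⁻ x, ENNReal.ofReal (frobeniusNormSq (fderiv ℝ (u t₁) x))) ≤ ENNReal.ofReal L →
            ENNReal.ofReal (2 * L) ≤ (∫⁻ x, ENNReal.ofReal (frobeniusNormSq (fderiv ℝ (u t₂) x))) →
            K * ν ^ 3 / L ^ 2 ≤ t₂ - t₁) →
        (∀ R ε : ℝ, 0 < R → 0 < ε → ∃ t' ∈ Set.Ico 0 T, ∀ t ∈ Set.Ico t' T,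
            ∀ x : EuclideanSpace ℝ (Fin 3), ∀ L : ℝ, 0 < L →
            (∀ s ∈ Set.Icc 0 t,
              (∫⁻ x, ENNReal.ofReal (frobeniusNormSq (fderiv ℝ (u s) x))) ≤ ENNReal.ofReal L) →
            3 * ν ^ 3 / L ^ 2 ≤ t →
            (∫⁻ y in Metric.ball x (R * ν ^ 2 / L), ENNReal.ofReal (frobeniusNormSq (fderiv ℝ (u t) y))) <
              ENNReal.ofReal (ε * L)) →
        (∀ θ : ℝ, 0 < θ → ∃ t' ∈ Set.Ico 0 T, ∀ t ∈ Set.Ico t' T,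
            ∀ x : EuclideanSpace ℝ (Fin 3), ∀ L : ℝ, 0 < L →
            (∀ s ∈ Set.Icc 0 t,
              (∫⁻ x, ENNReal.ofReal (frobeniusNormSq (fderiv ℝ (u s) x))) ≤ ENNReal.ofReal L) →
            ‖u t x‖ < θ * L / ν) →
        (∀ (tc : ℕ → ℝ) (x₁ x₂ : ℕ → EuclideanSpace ℝ (Fin 3)) (M : ℕ → ℝ) (θ R₀ D : ℝ),
          (∀ n, 0 < tc n ∧ tc n < T) → (∀ n, 0 < M n) →
          (∀ n, ∀ t ∈ Set.Icc 0 (tc n), ∀ x, ‖u t x‖ ≤ M n) →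
          Tendsto (fun n => tc n * M n ^ 2) atTop atTop →
          0 < θ → 0 < R₀ → (∀ n, ‖x₁ n - x₂ n‖ ≤ R₀ * (ν / M n)) →
          (∀ n, θ * M n ≤ ‖u (tc n) (x₁ n) - u (tc n) (x₂ n)‖) →
          (∀ R S : ℝ, 0 < R → 0 < S → ∀ᶠ n in atTop, ∀ t ∈ Set.Icc 0 (tc n), tc n - S * (ν / M n ^ 2) ≤ t →
            (∫⁻ y in Metric.ball (x₁ n) (R * (ν / M n)), ENNReal.ofReal (frobeniusNormSq (fderiv ℝ (u t) y))) ≤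
              ENNReal.ofReal (D * (ν * M n))) →
          False) →
        False) := by
  intro hK ν T hν hT u p hcl hLH hdec hnext _ _ _ _ h5
  obtain ⟨tb, x₁, x₂, M, θ, R₀, D, ha, hb, hc, hd, he, hf, hg, hh, hi⟩ := hK ν T hν hT u p hcl hLH hdec hnext
  exact h5 tb x₁ x₂ M θ R₀ D ha hb hc hd he hf hg hh hi

end Summit.NavierStokesRegularity.NavierStokesRegularity.Theorems.RecordZoomAncient.Birth

end
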